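import Literature.AlgebraicGeometry.Motives.HodgeStructureAbelianTypePolarizable
import Literature.AlgebraicGeometry.Motives.HodgeStructureLifting
import Literature.AlgebraicGeometry.Motives.HodgeStructureQuotient
import Literature.AlgebraicGeometry.HodgeTheory.WeightOneHodgeStructuresCurveSections
import HarnessLib

/-!
# Hodge structures of abelian type are stable under subobjects and quotients

Family `hodge`, layer `Literature/AlgebraicGeometry/Motives` (lane `lit-hodgefound`, Layer B node
B3-17 / TRIBUNAL-B B15: closure properties of `HodgeStructure.IsOfAbelianType`). THEOREMS ONLY;
no definition, no named fact.

Sources read verbatim. Y. André, *Pour une théorie inconditionnelle des motifs*, Publ. Math. IHÉS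
83 (1996) [Andre1996Motifs] (held text `paper:doi-10-1007-bf02698643`), §6.1 (p. 30): `ℳ(𝒜b)_𝒱`
is "la sous-catégorie tannakienne de `ℳ_𝒱` engendrée par les `𝔥(A)` et les motifs d'Artin" —
a Tannakian subcategory generated by a family of objects is, by definition, stable under
subobjects and quotients (and `⊗`, duals, sums); Thm. 0.4 (p. 8): `ℳ(𝒱)` is "semi-simple,
polarisée", so subobjects and quotients are direct summands. On the Hodge side: C. Voisin,
*Hodge Theory and Complex Algebraic Geometry I* [VoisinHodgeI2002], §7.3.1 Lemma 7.26, and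
C. Voisin, *Hodge and generalized Hodge conjectures, coniveau and algebraic cycles* (2025)
[Voisin2025], Prop. 2.11 and Cor. 2.12 (the category of polarisable rational Hodge structures is
semisimple; an injective morphism into a polarisable structure has a left inverse, a surjective
morphism from one has a section — the tree's
`HodgeStructure.Hom.exists_leftInverse_of_injective` and `HodgeStructure.Hom.exists_section_of_surjective`).

## What is proved

For a `ℚ`-Hodge structure `H` of abelian type (`HodgeStructure.IsOfAbelianType`; polarisable and
finite-dimensional by `IsOfAbelianType.isPolarizable` / `.finiteDimensional` of
`Motives/HodgeStructureAbelianTypePolarizable`):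

* `HodgeStructure.IsOfAbelianType.of_injective` — the source of an injective morphism of Hodge
  structures `H' → H` is of abelian type (subobjects);
* `HodgeStructure.IsOfAbelianType.of_surjective` — the target of a surjective morphism `H → H''`
  is of abelian type (quotients);
* `HodgeStructure.IsOfAbelianType.subHodgeStructure` — every sub-Hodge structure of `H`, with its
  induced Hodge structure, is of abelian type;
* `HodgeStructure.IsOfAbelianType.isAbelianTypeSummand` — the `ℚ`-subspace underlying any
  sub-Hodge structure of `H` is an abelian-type summand through `H`
  (`HodgeStructure.IsAbelianTypeSummand`, the piece-level predicate of the definition file).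
-/

noncomputable section

universe u v

namespace Literature.AlgebraicGeometry.Motives

namespace HodgeStructure

variable {V : Type u} [AddCommGroup V] [Module ℚ V]
variable {V' : Type v} [AddCommGroup V'] [Module ℚ V'] {w : ℤ}

/-- **Subobjects of structures of abelian type are of abelian type.** If `ι : H' → H` is an
injective morphism of `ℚ`-Hodge structures and `H` is of abelian type, then so is `H'`: `H` is
polarisable and finite-dimensional (`IsOfAbelianType.isPolarizable`, `.finiteDimensional`), so `ι`
has a left inverse `r` in the category of Hodge structures (Voisin I Lemma 7.26 / Voisin 2025
Prop. 2.11; the tree's `Hom.exists_leftInverse_of_injective`), and `H'` is the retract `(ι, r)` of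
`H` (`IsOfAbelianType.of_retract`). André, §6.1: `ℳ(𝒜b)` is a Tannakian SUBcategory, stable under
subobjects. [cite: Andre1996Motifs, §6.1 (p. 30) and Thm. 0.4 (p. 8)]
[cite: VoisinHodgeI2002, §7.3.1 Lemma 7.26] [cite: Voisin2025, Prop. 2.11] -/
theorem IsOfAbelianType.of_injective {H : HodgeStructure V w} (h : H.IsOfAbelianType)
    {H' : HodgeStructure V' w} (ι : H'.Hom H) (hι : Function.Injective ι.toLinearMap) :
    H'.IsOfAbelianType := by
  haveI := h.finiteDimensional
  obtain ⟨r, hr⟩ := ι.exists_leftInverse_of_injective hι h.isPolarizable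
  exact h.of_retract ι r fun v ↦ LinearMap.congr_fun hr v

/-- **Quotients of structures of abelian type are of abelian type.** If `π : H → H''` is a
surjective morphism of `ℚ`-Hodge structures and `H` is of abelian type, then so is `H''`: `π` has
a section `σ` in the category of Hodge structures (semisimplicity of polarisable structures,
Voisin 2025 Prop. 2.11 / Cor. 2.12; the tree's `Hom.exists_section_of_surjective`), and `H''` is
the retract `(σ, π)` of `H`. André, §6.1 / Thm. 0.4: `ℳ(𝒜b)` is stable under quotients.
[cite: Andre1996Motifs, §6.1 (p. 30) and Thm. 0.4 (p. 8)] [cite: Voisin2025, Prop. 2.11 and Cor. 2.12] -/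
theorem IsOfAbelianType.of_surjective {H : HodgeStructure V w} (h : H.IsOfAbelianType)
    {H'' : HodgeStructure V' w} (π : H.Hom H'') (hπ : Function.Surjective π.toLinearMap) :
    H''.IsOfAbelianType := by
  haveI := h.finiteDimensional
  obtain ⟨σ, hσ⟩ := π.exists_section_of_surjective h.isPolarizable hπ
  exact h.of_retract σ π fun v ↦ by
    show (π.comp σ).toLinearMap v = v
    rw [hσ]
    rfl

/-- **Sub-Hodge structures of a structure of abelian type are of abelian type** (with the
induced Hodge structure `SubHodgeStructure.toHodgeStructure`; the inclusion underlies an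
injective morphism, `SubHodgeStructure.exists_hom_subtype`).
[cite: Andre1996Motifs, §6.1 (p. 30)] [cite: VoisinHodgeI2002, §7.3.1 Def. 7.24 and Lemma 7.26] -/
theorem IsOfAbelianType.subHodgeStructure {H : HodgeStructure V w} (h : H.IsOfAbelianType)
    (S : SubHodgeStructure H) : S.toHodgeStructure.IsOfAbelianType := by
  obtain ⟨ι, hι⟩ := S.exists_hom_subtype
  exact h.of_injective ι (by rw [hι]; exact Subtype.val_injective)

/-- **The subspace of a sub-Hodge structure is an abelian-type summand.** If `H` is of abelian
type through `(j, r)` and `S` is a sub-Hodge structure of `H` with inclusion `ι` and a left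
inverse `ρ : H → S` (semisimplicity), then `S` is an abelian-type summand through `H`
(`IsAbelianTypeSummand H S`): keep `j` and replace `r` by `ι ∘ ρ ∘ r`, which retracts `j` on `S`
and has range in `S`. This is the form in which a route speaks of the Hodge type of a PIECE
`S ⊆ Hᵏ(X(ℂ); ℚ)` (definition file, `IsAbelianTypeSummand`). [cite: Andre1996Motifs, §6.1 (p. 30)]
[cite: VoisinHodgeI2002, §7.3.1 Lemma 7.26] [cite: Voisin2025, Prop. 2.11] -/
theorem IsOfAbelianType.isAbelianTypeSummand {H : HodgeStructure V w} (h : H.IsOfAbelianType)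
    (S : SubHodgeStructure H) : H.IsAbelianTypeSummand S.toSubmodule := by
  haveI := h.finiteDimensional
  have hpol := h.isPolarizable
  obtain ⟨ι, hι⟩ := S.exists_hom_subtype
  have hιinj : Function.Injective ι.toLinearMap := by rw [hι]; exact Subtype.val_injective
  obtain ⟨ρ, hρ⟩ := ι.exists_leftInverse_of_injective hιinj hpol
  obtain ⟨A, hA, M, hM, m, c, hw, j, r, hjr⟩ := h
  refine ⟨A, hA, M, hM, m, c, hw, j, (ι.comp ρ).comp r, fun v hv ↦ ?_, ?_⟩
  · show ι.toLinearMap (ρ.toLinearMap (r.toLinearMap (j.toLinearMap v))) = v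
    have hv' : ι.toLinearMap ⟨v, hv⟩ = v := by rw [hι]; rfl
    rw [hjr, ← hv', ← LinearMap.comp_apply (f := ρ.toLinearMap) (g := ι.toLinearMap)]
    conv_lhs => rw [show ρ.toLinearMap ∘ₗ ι.toLinearMap = LinearMap.id from hρ]
    rfl
  · rintro _ ⟨t, rfl⟩
    show ι.toLinearMap (ρ.toLinearMap (r.toLinearMap t)) ∈ S.toSubmodule
    rw [hι]
    exact Submodule.coe_mem _

/-! ### Quotient Hodge structures, cokernels, cohomology of complexes (via `HodgeStructureQuotient`) -/

/-- **The quotient `H/N` of a structure of abelian type by a sub-Hodge structure is of abelian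
type** (`HodgeStructure.quotient`; the projection `N.mkQHom` is a surjective morphism; André §6.1 /
Thm. 0.4: `ℳ(𝒜b)` is stable under quotients). [cite: Andre1996Motifs, §6.1 (p. 30) and Thm. 0.4 (p. 8)] -/
theorem IsOfAbelianType.quotient {H : HodgeStructure V w} (h : H.IsOfAbelianType)
    (N : SubHodgeStructure H) : (H.quotient N).IsOfAbelianType :=
  h.of_surjective N.mkQHom N.mkQHom_surjective

/-- **The cokernel of a morphism into a structure of abelian type is of abelian type**
(`Hom.coker`, André §6.1 / Thm. 0.4). [cite: Andre1996Motifs, §6.1 (p. 30) and Thm. 0.4 (p. 8)] -/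
theorem IsOfAbelianType.coker {H' : HodgeStructure V' w} {H : HodgeStructure V w}
    (h : H.IsOfAbelianType) (f : H'.Hom H) : f.coker.IsOfAbelianType :=
  h.quotient f.range

universe u'' in
/-- **The cohomology `ker g / im f` of a complex of Hodge structures whose middle term is of abelian
type is of abelian type** (`Hom.cohomology`; a subquotient — André §6.1 / Thm. 0.4).
[cite: Andre1996Motifs, §6.1 (p. 30) and Thm. 0.4 (p. 8)] -/
theorem IsOfAbelianType.cohomology {V'' : Type u''} [AddCommGroup V''] [Module ℚ V'']
    {H₁ : HodgeStructure V' w} {H₂ : HodgeStructure V w} {H₃ : HodgeStructure V'' w}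
    (h : H₂.IsOfAbelianType) (f : H₁.Hom H₂) (g : H₂.Hom H₃) (hfg : g.comp f = 0) :
    (f.cohomology g hfg).IsOfAbelianType :=
  (h.subHodgeStructure g.ker).quotient _

end HodgeStructure

end Literature.AlgebraicGeometry.Motives

end
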